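import Mathlib
import HarnessLib

/-!
# Belyi witnesses and the Belyi degree of a four-pointed projective line

A *Belyi map* on a smooth projective curve `X/ℚ̄` is a finite morphism `X → ℙ¹` unramified
outside `{0, 1, ∞}`; the *(absolute) Belyi degree* `deg_B(X)` is the minimal degree of such a map
[cite: Zapponi2009BelyiDegree, §1.1], [cite: Javanpeykar2014, §1.1].  The routes
`Summit.ABC.ABC.Theses.BelyiDegreeSmooth` / `…BelyiSqueeze` need the *pointed genus-0* version:
the minimal degree of a Belyi map `β : ℙ¹ → ℙ¹` for which a prescribed fourth point `t` is, like
`0, 1, ∞`, one of the *special points* `β⁻¹{0,1,∞}` — "the Belyi degree of the four-pointed line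
`(ℙ¹; 0, 1, ∞, t)`", written `deg_B(ℙ¹; 0,1,∞,t)` or `deg_B(t)`.

## The elementary normal form

Mathlib has no ramification theory for maps of curves, so we use the elementary polynomial normal
form that the route `BelyiDegreeSmooth` inlines in every one of its statements (items
`stmt-ABC-2245 … 2249`).  Write `β = p/q` with `p q : ℂ[X]` coprime and `d = max (deg p) (deg q)`
the degree of `β`.  The fibre `β⁻¹{0,1,∞} ⊆ ℙ¹(ℂ)` consists of

* the distinct complex roots of `p · q · (p − q)` (roots of `p` ↦ `0`, of `q` ↦ `∞`, of `p − q` ↦ `1`;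
  these three root sets are pairwise disjoint by coprimality), and
* the point `∞`, which lies over `{0,1,∞}` iff one of `deg p, deg q, deg (p − q)` drops below `d`.

By Riemann–Hurwitz, `#β⁻¹{0,1,∞} ≥ d + 2` for every rational map of degree `d ≥ 1`, with equality
iff `β` is unramified outside `{0,1,∞}` (a genus-0 dessin with `d` edges has `d + 2` vertices and
faces in total) [folklore; e.g. Goldring2011 Thm 3.2, the equality case of Mason–Stothers].
`HasBelyiWitness d t` records exactly the equality case *with `∞` special* (a degree drops and
`p·q·(p−q)` has `d + 1` distinct affine roots) together with `0, 1, t` special.  Requiring `∞` to be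
special loses nothing for the Belyi degree: if `β` is a witness with `∞ ∉ β⁻¹{0,1,∞}`, precompose
with the Möbius map `x ↦ t·x/(x + t − 1)` (for `t ∉ {0,1}`), which fixes `0, 1, t` and sends `∞` to
the special point `t`; the degree is unchanged.

## Contents

* `HasBelyiWitness d t` — the witness predicate (definitionally the route's inlined term `W(d,t)`;
  `hasBelyiWitness_iff` is `Iff.rfl`).
* `belyiDegree t := sInf {d | HasBelyiWitness d t}` — the Belyi degree of `(ℙ¹; 0,1,∞,t)`
  (junk value `0` when no witness exists, i.e. for transcendental `t`; by Belyi's theorem a witness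
  exists for every algebraic `t`, and for `t = a/c ∈ ℚ ∩ (0,1)` Belyi's map
  `c^c x^a (1−x)^b / (a^a b^b)` gives `belyiDegree (a/c) ≤ c` — route item `BelyiTrivialBound`,
  not proved here).
* API: `HasBelyiWitness.pos` (a witness has degree `≥ 1`), `belyiDegree_le`,
  `hasBelyiWitness_belyiDegree`, `belyiDegree_pos`, and the symmetry under `t ↦ 1 − t`
  (`HasBelyiWitness.one_sub`, `hasBelyiWitness_one_sub_iff`, `belyiDegree_one_sub`), obtained by
  precomposing `β` with `x ↦ 1 − x`.

## Not here (deliberately)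

* The symmetry `t ↦ 1/t` (precompose with `x ↦ 1/x`, i.e. reflect `p, q` to degree `d`) and the
  full anharmonic-group invariance; the equivalence of the root-count condition with "every critical
  value of `p/q` lies in `{0,1,∞}`"; Belyi's theorem (existence of a witness for algebraic `t`).
* `deg_B(X)` for curves of genus `≥ 1` (needs ramification of finite morphisms of curves; it is the
  quantity in Javanpeykar2014 Thm 1.1.1 and Zapponi2009BelyiDegree Thm 1.3).
* Monotonicity in `d` is *not* expected and not claimed (hence `sInf`, not "for all large `d`").
-/

namespace Literature.NumberTheory.DiophantineGeometry

open Polynomial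

/-- `HasBelyiWitness d t`: the four-pointed projective line `(ℙ¹_ℂ; 0, 1, ∞, t)` carries a Belyi
map of degree exactly `d` in the normal form with `∞` special.  Concretely: there are coprime
`p q : ℂ[X]` with `max (deg p) (deg q) = d` (so `β = p/q : ℙ¹ → ℙ¹` has degree `d`), one of
`deg p, deg q, deg (p − q)` is `< d` (so `β(∞) ∈ {0, ∞, 1}`), the polynomial `p·q·(p−q)` has exactly
`d + 1` distinct complex roots (so `#β⁻¹{0,1,∞} = d + 2`, the Riemann–Hurwitz equality case: `β` is
unramified outside `{0,1,∞}`), and `p·q·(p−q)` vanishes at `0`, `1` and `t` (so `0, 1, t` are special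
points).  This is *literally* the term `W(d,t)` inlined in the statements of route
`Summit.ABC.ABC.Theses.BelyiDegreeSmooth` (see `hasBelyiWitness_iff`).  Informal notion: a Belyi map
is a finite cover of `ℙ¹` unramified outside `{0,1,∞}`, of which this is the genus-0, Riemann–Hurwitz
normal form (folklore) [cite: Zapponi2009BelyiDegree, §1.1]. -/
def HasBelyiWitness (d : ℕ) (t : ℂ) : Prop :=
  ∃ p q : Polynomial ℂ, IsCoprime p q ∧ max p.natDegree q.natDegree = d ∧
    (p.natDegree < d ∨ q.natDegree < d ∨ (p - q).natDegree < d) ∧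
    (p * q * (p - q)).roots.toFinset.card = d + 1 ∧
    (p * q * (p - q)).eval 0 = 0 ∧ (p * q * (p - q)).eval 1 = 0 ∧ (p * q * (p - q)).eval t = 0

/-- Unfolding lemma: `HasBelyiWitness d t` is by definition the inlined witness term `W(d,t)` of
route `BelyiDegreeSmooth` [folklore]. -/
theorem hasBelyiWitness_iff (d : ℕ) (t : ℂ) :
    HasBelyiWitness d t ↔
      ∃ p q : Polynomial ℂ, IsCoprime p q ∧ max p.natDegree q.natDegree = d ∧
        (p.natDegree < d ∨ q.natDegree < d ∨ (p - q).natDegree < d) ∧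
        (p * q * (p - q)).roots.toFinset.card = d + 1 ∧
        (p * q * (p - q)).eval 0 = 0 ∧ (p * q * (p - q)).eval 1 = 0 ∧
        (p * q * (p - q)).eval t = 0 :=
  Iff.rfl

/-- The Belyi degree `deg_B(ℙ¹; 0, 1, ∞, t)` of the four-pointed line: the least `d` such that
`HasBelyiWitness d t`, i.e. the minimal degree of a Belyi map `ℙ¹ → ℙ¹` having `0, 1, ∞, t` among its
special points (genus-0, pointed analogue of the absolute Belyi degree of a curve
[cite: Zapponi2009BelyiDegree, §1.1]; cf. Javanpeykar2014 §1.1).  Junk value: `0` when no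
witness exists (`Nat.sInf_eq_zero`), which happens exactly for non-algebraic `t` by Belyi's theorem
(not proved here); a genuine Belyi degree is always `≥ 1` (`belyiDegree_pos`). -/
noncomputable def belyiDegree (t : ℂ) : ℕ :=
  sInf {d | HasBelyiWitness d t}

/-- A Belyi witness has positive degree: for `d = 0` the degree-drop clause is vacuously false
[folklore]. -/
theorem HasBelyiWitness.pos {d : ℕ} {t : ℂ} (h : HasBelyiWitness d t) : 0 < d := by
  obtain ⟨p, q, -, -, hdrop, -⟩ := h
  rcases hdrop with h | h | h <;> exact Nat.lt_of_le_of_lt (Nat.zero_le _) h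

/-- There is no Belyi witness of degree `0` [folklore]. -/
theorem not_hasBelyiWitness_zero (t : ℂ) : ¬ HasBelyiWitness 0 t :=
  fun h => (Nat.lt_irrefl 0) h.pos

/-- The Belyi degree is at most the degree of any witness [folklore]. -/
theorem belyiDegree_le {d : ℕ} {t : ℂ} (h : HasBelyiWitness d t) : belyiDegree t ≤ d :=
  Nat.sInf_le h

/-- If some witness exists, the Belyi degree is attained by a witness [folklore]. -/
theorem hasBelyiWitness_belyiDegree {t : ℂ} (h : ∃ d, HasBelyiWitness d t) :
    HasBelyiWitness (belyiDegree t) t :=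
  Nat.sInf_mem h

/-- If some witness exists, the Belyi degree is positive [folklore]. -/
theorem belyiDegree_pos {t : ℂ} (h : ∃ d, HasBelyiWitness d t) : 0 < belyiDegree t :=
  (hasBelyiWitness_belyiDegree h).pos

/-- Junk value: with no witness at all the Belyi degree is `0` [folklore]. -/
theorem belyiDegree_eq_zero_iff (t : ℂ) : belyiDegree t = 0 ↔ ∀ d, ¬ HasBelyiWitness d t := by
  constructor
  · intro h d hd
    have hpos := belyiDegree_pos ⟨d, hd⟩
    omega
  · intro h
    rw [belyiDegree, Nat.sInf_eq_zero]
    exact Or.inr (Set.eq_empty_iff_forall_notMem.mpr fun d hd => h d hd)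

/-! ### Symmetry `t ↦ 1 - t` -/

section OneSub

/-- The substitution `x ↦ 1 - x` as a polynomial, in the affine normal form `C a * X + C b` used by
`Polynomial.roots_comp_C_mul_X_add_C` [folklore]. -/
private noncomputable def oneSubX : ℂ[X] := C (-1) * X + C 1

/-- `oneSubX` evaluates to `1 - x` [folklore]. -/
private theorem eval_oneSubX (x : ℂ) : oneSubX.eval x = 1 - x := by
  simp [oneSubX]; ring

/-- `oneSubX` has degree `1` [folklore]. -/
private theorem natDegree_oneSubX : oneSubX.natDegree = 1 := by
  have h : oneSubX = -(X - C 1) := by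
    simp only [oneSubX, map_neg, map_one]
    ring
  rw [h, natDegree_neg, natDegree_X_sub_C]

/-- Precomposing with `x ↦ 1 - x` preserves the degree [folklore]. -/
private theorem natDegree_comp_oneSubX (f : ℂ[X]) : (f.comp oneSubX).natDegree = f.natDegree := by
  rw [natDegree_comp, natDegree_oneSubX, mul_one]

/-- The distinct zeros of `f(1 - x)` are the images under `x ↦ 1 - x` of those of `f` [folklore]. -/
private theorem roots_toFinset_comp_oneSubX (f : ℂ[X]) :
    (f.comp oneSubX).roots.toFinset = f.roots.toFinset.image (fun x => 1 - x) := by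
  have h := roots_comp_C_mul_X_add_C f (-1) 1 isUnit_one.neg
  have hinv : Ring.inverse (-1 : ℂ) = -1 := by
    rw [Ring.inverse_eq_inv]; norm_num
  rw [oneSubX, h, Multiset.toFinset_map]
  congr 1
  funext x
  rw [hinv]; ring

/-- `f(1 - x)` has as many distinct zeros as `f` [folklore]. -/
private theorem card_roots_toFinset_comp_oneSubX (f : ℂ[X]) :
    (f.comp oneSubX).roots.toFinset.card = f.roots.toFinset.card := by
  rw [roots_toFinset_comp_oneSubX]
  exact Finset.card_image_of_injective _ fun x y hxy => by simpa using hxy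

/-- Symmetry of Belyi witnesses under `t ↦ 1 - t`: precompose `β = p/q` with the Möbius map
`x ↦ 1 - x`, which swaps the special points `0, 1`, fixes `∞` and sends `1 - t ↦ t`; the degree and
the number of special points are unchanged [folklore]. -/
theorem HasBelyiWitness.one_sub {d : ℕ} {t : ℂ} (h : HasBelyiWitness d t) :
    HasBelyiWitness d (1 - t) := by
  obtain ⟨p, q, hcop, hmax, hdrop, hcard, h0, h1, ht⟩ := h
  have key : p.comp oneSubX * q.comp oneSubX * (p.comp oneSubX - q.comp oneSubX) =
      (p * q * (p - q)).comp oneSubX := by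
    rw [mul_comp, mul_comp, sub_comp]
  refine ⟨p.comp oneSubX, q.comp oneSubX, ?_, ?_, ?_, ?_, ?_, ?_, ?_⟩
  · obtain ⟨u, v, huv⟩ := hcop
    refine ⟨u.comp oneSubX, v.comp oneSubX, ?_⟩
    rw [← mul_comp, ← mul_comp, ← add_comp, huv, one_comp]
  · rw [natDegree_comp_oneSubX, natDegree_comp_oneSubX, hmax]
  · rw [← sub_comp, natDegree_comp_oneSubX, natDegree_comp_oneSubX, natDegree_comp_oneSubX]
    exact hdrop
  · rw [key, card_roots_toFinset_comp_oneSubX, hcard]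
  · rw [key, eval_comp, eval_oneSubX, sub_zero]
    exact h1
  · rw [key, eval_comp, eval_oneSubX, sub_self]
    exact h0
  · rw [key, eval_comp, eval_oneSubX, sub_sub_cancel]
    exact ht

end OneSub

/-- `HasBelyiWitness d` is invariant under `t ↦ 1 - t` [folklore]. -/
theorem hasBelyiWitness_one_sub_iff (d : ℕ) (t : ℂ) :
    HasBelyiWitness d (1 - t) ↔ HasBelyiWitness d t :=
  ⟨fun h => by simpa using h.one_sub, fun h => h.one_sub⟩

/-- The Belyi degree of `(ℙ¹; 0,1,∞,t)` is invariant under `t ↦ 1 - t` [folklore]. -/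
theorem belyiDegree_one_sub (t : ℂ) : belyiDegree (1 - t) = belyiDegree t := by
  simp only [belyiDegree, hasBelyiWitness_one_sub_iff]


/-! ### Symmetry `t ↦ t⁻¹` -/

section Inv

/-- Evaluating a reflected polynomial at `x⁻¹`: `(reflect N f)(x⁻¹) · x ^ N = f(x)` for `x ≠ 0`
(Mathlib's `eval₂_reflect_mul_pow`, specialised to `eval` over `ℂ`) [folklore]. -/
private theorem eval_reflect_inv_mul_pow {N : ℕ} {f : ℂ[X]} (hf : f.natDegree ≤ N) {x : ℂ}
    (hx : x ≠ 0) : (reflect N f).eval x⁻¹ * x ^ N = f.eval x := by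
  letI : Invertible x := invertibleOfNonzero hx
  have h := eval₂_reflect_mul_pow (RingHom.id ℂ) x N f hf
  rw [invOf_eq_inv] at h
  exact h

/-- For `y ≠ 0`: `y` is a zero of `reflect N f` iff `y⁻¹` is a zero of `f` [folklore]. -/
private theorem eval_reflect_eq_zero_iff {N : ℕ} {f : ℂ[X]} (hf : f.natDegree ≤ N) {y : ℂ}
    (hy : y ≠ 0) : (reflect N f).eval y = 0 ↔ f.eval y⁻¹ = 0 := by
  have h := eval_reflect_inv_mul_pow hf (inv_ne_zero hy)
  rw [inv_inv] at h
  rw [← h]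
  refine ⟨fun h0 => by rw [h0, zero_mul], fun h0 => ?_⟩
  rcases mul_eq_zero.mp h0 with h1 | h1
  · exact h1
  · exact absurd h1 (pow_ne_zero _ (inv_ne_zero hy))

/-- The constant term of `reflect N f` is the coefficient of `X ^ N` in `f` [folklore]. -/
private theorem eval_zero_reflect (N : ℕ) (f : ℂ[X]) : (reflect N f).eval 0 = f.coeff N := by
  rw [← coeff_zero_eq_eval_zero, coeff_reflect, revAt_zero]

/-- If `deg f ≤ N` and `0 < N` then `f.coeff N = 0 ↔ deg f < N` (convention `deg 0 = 0`)
[folklore]. -/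
private theorem coeff_eq_zero_iff_natDegree_lt {N : ℕ} {f : ℂ[X]} (hf : f.natDegree ≤ N)
    (hN : 0 < N) : f.coeff N = 0 ↔ f.natDegree < N := by
  refine ⟨fun h => lt_of_le_of_ne hf fun hdeg => ?_, coeff_eq_zero_of_natDegree_lt⟩
  by_cases hf0 : f = 0
  · rw [hf0, natDegree_zero] at hdeg
    omega
  · have : f.leadingCoeff = 0 := by rwa [leadingCoeff, hdeg]
    exact hf0 (leadingCoeff_eq_zero.mp this)

/-- Degree of a reflection: `deg (reflect N f) < N ↔ f(0) = 0` when `deg f ≤ N`, `0 < N`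
[folklore]. -/
private theorem natDegree_reflect_lt_iff {N : ℕ} {f : ℂ[X]} (hf : f.natDegree ≤ N) (hN : 0 < N) :
    (reflect N f).natDegree < N ↔ f.eval 0 = 0 := by
  have hle : (reflect N f).natDegree ≤ N := natDegree_reflect_le.trans (max_le le_rfl hf)
  rw [← coeff_eq_zero_iff_natDegree_lt hle hN, coeff_reflect, ← coeff_zero_eq_eval_zero]
  simp [revAt_le le_rfl]

/-- Degree of a reflection: `deg (reflect N f) = N ↔ f(0) ≠ 0` when `deg f ≤ N`, `0 < N`
[folklore]. -/
private theorem natDegree_reflect_eq_iff {N : ℕ} {f : ℂ[X]} (hf : f.natDegree ≤ N) (hN : 0 < N) :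
    (reflect N f).natDegree = N ↔ f.eval 0 ≠ 0 := by
  have hle : (reflect N f).natDegree ≤ N := natDegree_reflect_le.trans (max_le le_rfl hf)
  rw [← not_iff_not, not_not, ← natDegree_reflect_lt_iff hf hN]
  exact ⟨fun h => lt_of_le_of_ne hle h, fun h => h.ne⟩

/-- Coprime polynomials have no common zero [folklore]. -/
private theorem not_common_root_of_isCoprime {p q : ℂ[X]} (h : IsCoprime p q) (x : ℂ)
    (hp : p.eval x = 0) (hq : q.eval x = 0) : False := by
  obtain ⟨u, v, huv⟩ := h
  have := congrArg (eval x) huv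
  rw [eval_add, eval_mul, eval_mul, hp, hq, eval_one] at this
  simp at this

/-- The distinct zeros of `reflect N F` (for `F ≠ 0`, `deg F < N`, `F(0) = 0`): zero, together with
the inverses of the non-zero zeros of `F`; hence as many as `F` has [folklore]. -/
private theorem card_roots_toFinset_reflect {N : ℕ} {F : ℂ[X]} (hF0 : F ≠ 0)
    (hdeg : F.natDegree < N) (hev : F.eval 0 = 0) :
    (reflect N F).roots.toFinset.card = F.roots.toFinset.card := by
  classical
  have hle : F.natDegree ≤ N := hdeg.le
  have hR0 : reflect N F ≠ 0 := fun h => hF0 (reflect_eq_zero_iff.mp h)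
  -- the set of distinct zeros of the reflection
  have hset : (reflect N F).roots.toFinset =
      insert 0 ((F.roots.toFinset.erase 0).image (fun x => x⁻¹)) := by
    ext x
    simp only [Multiset.mem_toFinset, mem_roots', ne_eq, IsRoot.def, Finset.mem_insert,
      Finset.mem_image, Finset.mem_erase]
    constructor
    · rintro ⟨-, hx⟩
      by_cases hx0 : x = 0
      · exact Or.inl hx0
      · refine Or.inr ⟨x⁻¹, ⟨inv_ne_zero hx0, hF0, ?_⟩, inv_inv x⟩
        exact (eval_reflect_eq_zero_iff hle hx0).mp hx
    · rintro (rfl | ⟨y, ⟨hy0, -, hy⟩, rfl⟩)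
      · exact ⟨hR0, by rw [eval_zero_reflect]; exact coeff_eq_zero_of_natDegree_lt hdeg⟩
      · exact ⟨hR0, (eval_reflect_eq_zero_iff hle (inv_ne_zero hy0)).mpr (by rw [inv_inv]; exact hy)⟩
  have hnotin : (0 : ℂ) ∉ (F.roots.toFinset.erase 0).image (fun x => x⁻¹) := by
    simp only [Finset.mem_image, Finset.mem_erase, ne_eq, not_exists, not_and, and_imp]
    intro y hy0 _ h
    exact hy0 (inv_eq_zero.mp h)
  have hmem : (0 : ℂ) ∈ F.roots.toFinset := by
    rw [Multiset.mem_toFinset, mem_roots', IsRoot.def]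
    exact ⟨hF0, hev⟩
  rw [hset, Finset.card_insert_of_notMem hnotin,
    Finset.card_image_of_injective _ inv_injective, Finset.card_erase_of_mem hmem]
  have hpos : 0 < F.roots.toFinset.card := Finset.card_pos.mpr ⟨0, hmem⟩
  omega

/-- Symmetry of Belyi witnesses under `t ↦ t⁻¹` (`t ≠ 0`): precompose `β = p/q` with the Möbius
map `x ↦ 1/x`, i.e. replace `p, q` by their reflections `X^d p(1/X), X^d q(1/X)`; this swaps the
special points `0, ∞`, fixes `1` and sends `t⁻¹ ↦ t`; degree and number of special points are
unchanged [folklore]. -/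
theorem HasBelyiWitness.inv {d : ℕ} {t : ℂ} (h : HasBelyiWitness d t) (ht0 : t ≠ 0) :
    HasBelyiWitness d t⁻¹ := by
  have hd : 0 < d := h.pos
  obtain ⟨p, q, hcop, hmax, hdrop, hcard, h0, h1, ht⟩ := h
  have hp : p.natDegree ≤ d := hmax ▸ le_max_left _ _
  have hq : q.natDegree ≤ d := hmax ▸ le_max_right _ _
  have hpq : (p - q).natDegree ≤ d := (natDegree_sub_le _ _).trans (max_le hp hq)
  set F := p * q * (p - q) with hF
  -- `F ≠ 0` (it has `d + 1 ≥ 1` distinct zeros), hence `p, q, p - q ≠ 0`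
  have hF0 : F ≠ 0 := by
    intro hz
    rw [hz, roots_zero, Multiset.toFinset_zero, Finset.card_empty] at hcard
    omega
  have hp0 : p ≠ 0 := fun hz => hF0 (by rw [hF, hz, zero_mul, zero_mul])
  have hq0 : q ≠ 0 := fun hz => hF0 (by rw [hF, hz, mul_zero, zero_mul])
  have hpq0 : p - q ≠ 0 := fun hz => hF0 (by rw [hF, hz, mul_zero])
  -- the degree drop says exactly `deg F < 3d`
  have hFdeg : F.natDegree < d + d + d := by
    rw [hF, natDegree_mul (mul_ne_zero hp0 hq0) hpq0, natDegree_mul hp0 hq0]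
    omega
  -- the reflected pair
  have hPQ : reflect d p - reflect d q = reflect d (p - q) := (reflect_sub _ _ _).symm
  have key : reflect d p * reflect d q * (reflect d p - reflect d q) = reflect (d + d + d) F := by
    rw [hPQ, hF, reflect_mul _ _ (natDegree_mul_le.trans (add_le_add hp hq)) hpq,
      reflect_mul _ _ hp hq]
  -- `F(0) = p(0) q(0) (p - q)(0)`
  have hev0 : p.eval 0 * q.eval 0 * (p - q).eval 0 = 0 := by rwa [← eval_mul, ← eval_mul]
  refine ⟨reflect d p, reflect d q, ?_, ?_, ?_, ?_, ?_, ?_, ?_⟩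
  · -- coprimality: no common zero (ℂ is algebraically closed)
    refine (isCoprime_iff_aeval_ne_zero_of_isAlgClosed ℂ ℂ _ _).mpr fun a => ?_
    rw [coe_aeval_eq_eval]
    by_contra hboth
    simp only [not_or, not_not] at hboth
    obtain ⟨hPa, hQa⟩ := hboth
    by_cases ha : a = 0
    · subst ha
      rw [eval_zero_reflect] at hPa hQa
      have hp' := (coeff_eq_zero_iff_natDegree_lt hp hd).mp hPa
      have hq' := (coeff_eq_zero_iff_natDegree_lt hq hd).mp hQa
      have : max p.natDegree q.natDegree < d := max_lt hp' hq'
      omega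
    · exact not_common_root_of_isCoprime hcop a⁻¹ ((eval_reflect_eq_zero_iff hp ha).mp hPa)
        ((eval_reflect_eq_zero_iff hq ha).mp hQa)
  · -- degree `d`: not both `p(0) = 0` and `q(0) = 0`
    have hP : (reflect d p).natDegree ≤ d := natDegree_reflect_le.trans (max_le le_rfl hp)
    have hQ : (reflect d q).natDegree ≤ d := natDegree_reflect_le.trans (max_le le_rfl hq)
    by_cases hpz : p.eval 0 = 0
    · have hqz : q.eval 0 ≠ 0 := fun hqz => not_common_root_of_isCoprime hcop 0 hpz hqz
      rw [(natDegree_reflect_eq_iff hq hd).mpr hqz]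
      exact max_eq_right hP
    · rw [(natDegree_reflect_eq_iff hp hd).mpr hpz]
      exact max_eq_left hQ
  · -- degree drop: one of `p(0), q(0), (p - q)(0)` vanishes since `F(0) = 0`
    rw [hPQ, natDegree_reflect_lt_iff hp hd, natDegree_reflect_lt_iff hq hd,
      natDegree_reflect_lt_iff hpq hd]
    rcases mul_eq_zero.mp hev0 with h' | h'
    · exact (mul_eq_zero.mp h').imp_right Or.inl
    · exact Or.inr (Or.inr h')
  · -- number of special affine points
    rw [key, card_roots_toFinset_reflect hF0 hFdeg h0, hcard]
  · -- `0` is special (because `∞` was)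
    rw [key, eval_zero_reflect]
    exact coeff_eq_zero_of_natDegree_lt hFdeg
  · -- `1` is special
    rw [key, (eval_reflect_eq_zero_iff hFdeg.le one_ne_zero), inv_one]
    exact h1
  · -- `t⁻¹` is special
    rw [key, (eval_reflect_eq_zero_iff hFdeg.le (inv_ne_zero ht0)), inv_inv]
    exact ht

end Inv

/-- `HasBelyiWitness d` is invariant under `t ↦ t⁻¹` [folklore]. -/
theorem hasBelyiWitness_inv_iff (d : ℕ) (t : ℂ) :
    HasBelyiWitness d t⁻¹ ↔ HasBelyiWitness d t := by
  by_cases ht : t = 0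
  · simp [ht]
  · exact ⟨fun h => by simpa using h.inv (inv_ne_zero ht), fun h => h.inv ht⟩

/-- The Belyi degree of `(ℙ¹; 0,1,∞,t)` is invariant under `t ↦ t⁻¹` [folklore]. -/
theorem belyiDegree_inv (t : ℂ) : belyiDegree t⁻¹ = belyiDegree t := by
  simp only [belyiDegree, hasBelyiWitness_inv_iff]

end Literature.NumberTheory.DiophantineGeometry
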